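import Summits.QuantumFields.YangMills.Theorems.BalabanLadderUVSeamRecGaussianCalibrationMarkov
import Literature.Probability.LatticeModels.LatticeGreenFourCertificate
import HarnessLib

/-!
# Crux `UVSeamRec` (stmt-QuantumFields-20043), free-field calibration of (RM), file 5: the (split-cl) half — the Gaussian TILTED-MINIMUM
# identity (classical response of a cube) and the EXACT background-field split of the free-field kernel, with zero influence

Helper file (`--supports stmt-QuantumFields-20043`) of the seam seat `ym-20043-seam-s2` (gen 4); theorems only, no definitions.
WHY.  The documented discharge architecture (β-cl) of the registered v5(α) stub `BirthV5A.stub_responseMomentsOdd6 : UV → (RM)` (glue p548409,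
candidates v6/v7) has three measure-side binders: (split-cl) `ClassicalResponse.SplitCl` — `(R⁴/C₁)|kerE − p| ≤ A₀ + carrierCl + influenceAt` with
`carrierCl = (βR⁴/C)·classicalResponse`, `classicalResponse = (tiltedMin 0 − tiltedMin s)/s` (p546887) —, (GD), and their output (RM).  Files 1–4 of this
series (gen 3) proved (GD) (signed form) and (RM) for the lattice GFF of `ℤ⁴` and left the (split) half untested.  THIS FILE: in the free field (split-cl)
holds EXACTLY, with influence `≡ 0`, two-sidedly, and the carrier IS the Gaussian classical response.
WHAT (GFF `ν` of `ℤ^d`, tree `IsDiscreteGFF`; finite `Λ`; `h = φ − ψ^Λ`, `ψ^Λ = dirichletField Λ φ`; bond `(x, x+e_j) ⊆ Λ`, bond energy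
`Q(φ) = ½(∇_jφ(x))²`, `L = ∇_jh(x)`, `g = E_Λ(δ_{x+e_j} − δ_x)`):
* §1–§3 (deterministic, any charge `a`): the Gaussian twin of `ClassicalResponse.tiltedMin`: over interior perturbations `ψ` (`= 0` off `Λ`) of the
  background, `min_ψ [½𝓔_Λ(ψ) − (s/2)(L + ⟨a,ψ⟩)²] = −(s/2)L²/(1 − s·E_Λ(a))` for `0 ≤ s`, `s·E_Λ(a) < 1` (`isLeast_tiltedDirichlet`; attained at
  `ψ⋆ = (sL/(1 − sE_Λ(a)))·G_Λa`; key step `⟨a,ψ⟩² ≤ E_Λ(a)·𝓔_Λ(ψ)` from the tree's Dirichlet variational principle optimised in the charge); hence the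
  GAUSSIAN CLASSICAL RESPONSE `(m₀ − m_s)/s = (L²/2)/(1 − s·E_Λ(a))` (`gaussClassicalResponse_eq`): the background bond energy amplified by
  `(1 − s g)⁻¹ ∈ [1, 16/11]` (`d = 4`, `s ≤ 1`; at `s = 1` the tilt removes the centre bond from the classical energy, as `tiltedMin 1` removes the centre plaquette).
* §4 (`d ≥ 3`): `g = ∫(∇_jψ^Λ(x))² dν ≤ latticeGreen 0 − latticeGreen e_j` (`< 5/16` in `d = 4`) and THE SPLIT
  `ν[Q | σ(φ_w : w ∉ Λ)] − ∫Q = Q(h) − ∫Q(h)` a.e., `Q(h) = (1 − s g)·CR_s`, `CR_s` the Gaussian classical response (`condExp_bondEnergy_sub_integral`,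
  `bondEnergy_eq_mul_gaussClassicalResponse`): `|ν[Q|ext] − ∫Q| ≤ (1 − s g)CR_s + ∫Q(h)` AND `ν[Q|ext] − ∫Q ≥ (1 − s g)CR_s − ∫Q(h)`.
* §5 (`d = 4`, cubes `x + sbox(R+1)`, `R ≥ 1`, `s ∈ [0,1]`, absolute `v` of file 3): `R⁴|ν[Q|ext] − ∫Q| ≤ v/2 + R⁴Q(h)`, `R⁴Q(h) − v/2 ≤ R⁴(ν[Q|ext] − ∫Q)`,
  `11/16 ≤ 1 − s g ≤ 1` (`gff_splitCl`) — `SplitCl`'s letters at `β = 1`, `C₁ = 1`: `A₀ = v/2`, carrier `R⁴(1 − s g)CR_s ≤ R⁴CR_s` (`carrierCl`, `C = 1`), `influenceAt ≡ 0`.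
LOCATED CONTENT (owner's/LEAD's pen): in the Gaussian model the background-field split is an IDENTITY — all exterior dependence of the kernel is the
classical response of the cube, the influence functional is idle, the `A₀`-slot is the mean response `∫Q(h) = O(R⁻⁴)`; `CR_s` is 2-homogeneous in the
field, so at inverse temperature `β` (`φ ↦ φ/√β`) `β·R⁴·CR_s` is β-free while `R⁴|kerE − p| = O(1/β)`: LEAD g8's power counting `C_s = O(β₁C₁)`,
`A₀ = O(1/(β₁C₁))` is exact here.  Not tested by the free field: the large-field half itself (there is none), gauge covariance, the interacting content.
No sorry, standard axioms.  HONEST FRAMING: finite-dimensional quadratic optimisation + the Markov property of the lattice FREE field; a consistency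
CALIBRATION of ONE binder of the documented discharge architecture of ONE OPEN stub of a CONDITIONAL chain; nothing of E0′, NT or the gap; not Clay.
References: Friedli–Velenik 2017, Ch. 8 (Prop. 8.7, Thm. 8.21); Glimm–Jaffe 1987 §9.5; Salmhofer–Seiler 1991 (A.60) via `latticeGreen_four_zero_lt`.
-/

set_option autoImplicit false

noncomputable section

open MeasureTheory ProbabilityTheory Finset
open Literature.Probability.LatticeModels
open Literature.MathematicalPhysics.QuantumFieldTheory.LatticeForm (e)
open Summit.QuantumFields.YangMills.Theorems.WeakCouplingRates.HarmonicInterior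

namespace Summit.QuantumFields.YangMills.Cruxes.UVSeamRec.GaussianCalibration

/-! ## §1 The one-dimensional tilted quadratic -/

/-- Completing the square: for `g > 0`, `s g < 1`: `−(s/2)L²/(1 − s g) ≤ u²/(2g) − (s/2)(L + u)²`
(the difference is `((1 − s g)u − s g L)²/(2g(1 − s g))`). [folklore] -/
theorem tiltQuadratic_lower_bound {g s : ℝ} (hg : 0 < g) (hsg : s * g < 1) (L u : ℝ) :
    -(s / 2 * L ^ 2 / (1 - s * g)) ≤ u ^ 2 / (2 * g) - s / 2 * (L + u) ^ 2 := by
  have h1 : 0 < 1 - s * g := by linarith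
  have hg' : g ≠ 0 := hg.ne'
  have h1' : (1 - s * g) ≠ 0 := h1.ne'
  have h1'' : (1 - g * s) ≠ 0 := by rw [mul_comm]; exact h1'
  have key : u ^ 2 / (2 * g) - s / 2 * (L + u) ^ 2 + s / 2 * L ^ 2 / (1 - s * g) =
      ((1 - s * g) * u - s * g * L) ^ 2 / (2 * g * (1 - s * g)) := by
    field_simp
    ring
  have h2 : 0 ≤ ((1 - s * g) * u - s * g * L) ^ 2 / (2 * g * (1 - s * g)) := by positivity
  linarith

/-! ## §2 Dirichlet form, Dirichlet energy, and the constrained minimum -/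

section Dirichlet

variable {d : ℕ}

/-- Homogeneity of the Dirichlet Green energy: `E_Λ(t·a) = t²·E_Λ(a)`. [folklore] -/
theorem dirichletEnergy_const_mul (Λ : Finset (Site d)) (t : ℝ) (a : Site d → ℝ) :
    dirichletEnergy Λ (fun y => t * a y) = t ^ 2 * dirichletEnergy Λ a := by
  rw [dirichletEnergy_eq_sum_sum, dirichletEnergy_eq_sum_sum, Finset.mul_sum]
  refine Finset.sum_congr rfl fun x _ => ?_
  rw [Finset.mul_sum]
  exact Finset.sum_congr rfl fun y _ => by ring

/-- Homogeneity of the Dirichlet form: `𝓔_Λ(c·u) = c²·𝓔_Λ(u)`. [folklore] -/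
theorem dirichletForm_const_mul (Λ : Finset (Site d)) (c : ℝ) (u : Site d → ℝ) :
    dirichletForm Λ (fun y => c * u y) = c ^ 2 * dirichletForm Λ u := by
  unfold dirichletForm
  rw [Finset.mul_sum]
  refine Finset.sum_congr rfl fun x _ => ?_
  rw [latticeLaplacianZd_const_mul]
  ring

/-- Pairing a charge with a multiple of its own Green potential: `⟨a, c·G_Λ a⟩_Λ = c·E_Λ(a)`. [folklore] -/
theorem sum_mul_const_mul_dirichletSolution (Λ : Finset (Site d)) (a : Site d → ℝ) (c : ℝ) :
    ∑ y ∈ Λ, a y * (c * dirichletSolution Λ a y) = c * dirichletEnergy Λ a := by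
  unfold dirichletEnergy
  rw [Finset.mul_sum]
  exact Finset.sum_congr rfl fun y _ => by ring

/-- The Dirichlet form of a multiple of a Green potential: `𝓔_Λ(c·G_Λ a) = c²·E_Λ(a)` (`d ≥ 1`). [folklore] -/
theorem dirichletForm_const_mul_dirichletSolution (hd : 0 < d) (Λ : Finset (Site d)) (a : Site d → ℝ) (c : ℝ) :
    dirichletForm Λ (fun y => c * dirichletSolution Λ a y) = c ^ 2 * dirichletEnergy Λ a := by
  rw [dirichletForm_const_mul, dirichletEnergy_eq_dirichletForm hd]

/-- **The constrained Dirichlet minimum** (Cauchy–Schwarz in the Dirichlet inner product, `d ≥ 1`): for `ψ` vanishing off `Λ` and any charge `a`,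
`(Σ_{y∈Λ} a_y ψ_y)² ≤ E_Λ(a)·𝓔_Λ(ψ)`: the tree's variational principle `2⟨ta,ψ⟩ − 𝓔_Λ(ψ) ≤ t²E_Λ(a)` for all `t` (a non-negative quadratic in `t`,
so its discriminant is `≤ 0`). [cite: GlimmJaffe1987, §9.5 (9.5.8)–(9.5.10)] -/
theorem sq_sum_mul_le_dirichletEnergy_mul_dirichletForm (hd : 0 < d) (Λ : Finset (Site d)) (a : Site d → ℝ)
    {ψ : Site d → ℝ} (hψ : ∀ y ∉ Λ, ψ y = 0) :
    (∑ y ∈ Λ, a y * ψ y) ^ 2 ≤ dirichletEnergy Λ a * dirichletForm Λ ψ := by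
  set P := ∑ y ∈ Λ, a y * ψ y with hP_def
  have hvar : ∀ t : ℝ, 0 ≤ dirichletEnergy Λ a * (t * t) + (-(2 * P)) * t + dirichletForm Λ ψ := by
    intro t
    have h := two_mul_sum_mul_sub_dirichletForm_le_dirichletEnergy hd Λ (fun y => t * a y) hψ
    rw [dirichletEnergy_const_mul] at h
    have e1 : ∑ y ∈ Λ, t * a y * ψ y = t * P := by
      rw [hP_def, Finset.mul_sum]
      exact Finset.sum_congr rfl fun y _ => by ring
    rw [e1] at h
    nlinarith
  have h := discrim_le_zero hvar
  rw [discrim] at h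
  nlinarith

/-! ## §3 The tilted Dirichlet minimum: the Gaussian twin of `ClassicalResponse.tiltedMin` / `classicalResponse` -/

/-- **Lower bound for the tilted conditional energy**: for `0 ≤ s`, `s·E_Λ(a) < 1`, every `L` and every `ψ` vanishing off `Λ`,
`−(s/2)·L²/(1 − s·E_Λ(a)) ≤ ½𝓔_Λ(ψ) − (s/2)(L + ⟨a,ψ⟩_Λ)²`. [folklore] -/
theorem tiltedDirichlet_lower_bound (hd : 0 < d) (Λ : Finset (Site d)) (a : Site d → ℝ) {s : ℝ} (hs : 0 ≤ s)
    (hsg : s * dirichletEnergy Λ a < 1) (L : ℝ) {ψ : Site d → ℝ} (hψ : ∀ y ∉ Λ, ψ y = 0) :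
    -(s / 2 * L ^ 2 / (1 - s * dirichletEnergy Λ a)) ≤
      dirichletForm Λ ψ / 2 - s / 2 * (L + ∑ y ∈ Λ, a y * ψ y) ^ 2 := by
  set g := dirichletEnergy Λ a with hg_def
  set u := ∑ y ∈ Λ, a y * ψ y with hu_def
  have hcs : u ^ 2 ≤ g * dirichletForm Λ ψ := sq_sum_mul_le_dirichletEnergy_mul_dirichletForm hd Λ a hψ
  have hF : 0 ≤ dirichletForm Λ ψ := dirichletForm_nonneg' Λ hψ
  have hg : 0 ≤ g := dirichletEnergy_nonneg hd Λ a
  by_cases hg0 : g = 0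
  · have hu : u = 0 := by
      rw [hg0, zero_mul] at hcs
      exact pow_eq_zero_iff two_ne_zero |>.1 (le_antisymm hcs (sq_nonneg u))
    rw [hg0, hu, mul_zero, sub_zero, div_one, add_zero]
    have h2 : 0 ≤ s / 2 * L ^ 2 := by positivity
    linarith
  · have hgpos : 0 < g := lt_of_le_of_ne hg (Ne.symm hg0)
    have h1 := tiltQuadratic_lower_bound hgpos hsg L u
    have h2 : u ^ 2 / (2 * g) ≤ dirichletForm Λ ψ / 2 := by
      rw [div_le_div_iff₀ (by positivity) two_pos]
      nlinarith
    linarith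

/-- **The tilted minimum is attained** at `ψ⋆ = (sL/(1 − sE_Λ(a)))·G_Λ a`:
`½𝓔_Λ(ψ⋆) − (s/2)(L + ⟨a,ψ⋆⟩)² = −(s/2)L²/(1 − sE_Λ(a))`. [folklore] -/
theorem tiltedDirichlet_eq_of_optimal (hd : 0 < d) (Λ : Finset (Site d)) (a : Site d → ℝ) {s : ℝ}
    (hsg : s * dirichletEnergy Λ a < 1) (L : ℝ) :
    dirichletForm Λ (fun y => s * L / (1 - s * dirichletEnergy Λ a) * dirichletSolution Λ a y) / 2 -
        s / 2 * (L + ∑ y ∈ Λ, a y * (s * L / (1 - s * dirichletEnergy Λ a) * dirichletSolution Λ a y)) ^ 2 =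
      -(s / 2 * L ^ 2 / (1 - s * dirichletEnergy Λ a)) := by
  rw [dirichletForm_const_mul_dirichletSolution hd, sum_mul_const_mul_dirichletSolution]
  have h1 : (1 - s * dirichletEnergy Λ a) ≠ 0 := by intro h; linarith
  field_simp
  ring

/-- **The Gaussian tilted-minimum identity** (twin of `ClassicalResponse.tiltedMin`): for `0 ≤ s`, `s·E_Λ(a) < 1`,
`min {½𝓔_Λ(ψ) − (s/2)(L + ⟨a,ψ⟩_Λ)² : ψ = 0 off Λ} = −(s/2)·L²/(1 − s·E_Λ(a))`, an ATTAINED minimum over the non-compact fibre. [folklore] -/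
theorem isLeast_tiltedDirichlet (hd : 0 < d) (Λ : Finset (Site d)) (a : Site d → ℝ) {s : ℝ} (hs : 0 ≤ s)
    (hsg : s * dirichletEnergy Λ a < 1) (L : ℝ) :
    IsLeast ((fun ψ : Site d → ℝ => dirichletForm Λ ψ / 2 - s / 2 * (L + ∑ y ∈ Λ, a y * ψ y) ^ 2) ''
        {ψ : Site d → ℝ | ∀ y ∉ Λ, ψ y = 0})
      (-(s / 2 * L ^ 2 / (1 - s * dirichletEnergy Λ a))) := by
  refine ⟨⟨fun y => s * L / (1 - s * dirichletEnergy Λ a) * dirichletSolution Λ a y, fun y hy => ?_,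
    tiltedDirichlet_eq_of_optimal hd Λ a hsg L⟩, ?_⟩
  · simp only [dirichletSolution_eq_zero Λ a hy, mul_zero]
  · rintro v ⟨ψ, hψ, rfl⟩
    exact tiltedDirichlet_lower_bound hd Λ a hs hsg L hψ

/-- The minimum VALUE `m_s = −(s/2)L²/(1 − sE_Λ(a))` as an `sInf` (`m₀ = 0`: the background itself minimises the untilted energy). [folklore] -/
theorem sInf_tiltedDirichlet_eq (hd : 0 < d) (Λ : Finset (Site d)) (a : Site d → ℝ) {s : ℝ} (hs : 0 ≤ s)
    (hsg : s * dirichletEnergy Λ a < 1) (L : ℝ) :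
    sInf ((fun ψ : Site d → ℝ => dirichletForm Λ ψ / 2 - s / 2 * (L + ∑ y ∈ Λ, a y * ψ y) ^ 2) ''
        {ψ : Site d → ℝ | ∀ y ∉ Λ, ψ y = 0}) = -(s / 2 * L ^ 2 / (1 - s * dirichletEnergy Λ a)) :=
  (isLeast_tiltedDirichlet hd Λ a hs hsg L).csInf_eq

/-- **The Gaussian classical response** (twin of `ClassicalResponse.classicalResponse = (tiltedMin 0 − tiltedMin s)/s`): for `0 < s`, `s·E_Λ(a) < 1`,
`(m₀ − m_s)/s = (L²/2)/(1 − s·E_Λ(a))` — the background observable `L²/2` amplified by `(1 − s·E_Λ(a))⁻¹ ≥ 1` (so it DOMINATES `L²/2`, the twin of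
`ClassicalResponse.deficit_le_classicalResponse`). [folklore] -/
theorem gaussClassicalResponse_eq (hd : 0 < d) (Λ : Finset (Site d)) (a : Site d → ℝ) {s : ℝ} (hs : 0 < s)
    (hsg : s * dirichletEnergy Λ a < 1) (L : ℝ) :
    (sInf ((fun ψ : Site d → ℝ => dirichletForm Λ ψ / 2 - 0 / 2 * (L + ∑ y ∈ Λ, a y * ψ y) ^ 2) ''
          {ψ : Site d → ℝ | ∀ y ∉ Λ, ψ y = 0}) -
        sInf ((fun ψ : Site d → ℝ => dirichletForm Λ ψ / 2 - s / 2 * (L + ∑ y ∈ Λ, a y * ψ y) ^ 2) ''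
          {ψ : Site d → ℝ | ∀ y ∉ Λ, ψ y = 0})) / s =
      L ^ 2 / 2 / (1 - s * dirichletEnergy Λ a) := by
  rw [sInf_tiltedDirichlet_eq hd Λ a le_rfl (by rw [zero_mul]; exact one_pos) L, sInf_tiltedDirichlet_eq hd Λ a hs.le hsg L]
  have h1 : (1 - s * dirichletEnergy Λ a) ≠ 0 := by intro h; linarith
  field_simp
  ring

/-- **The background observable IS `(1 − s·E_Λ(a))` times the Gaussian classical response**: `L²/2 = (1 − sE_Λ(a))·[(m₀ − m_s)/s]` for `0 < s`,
`sE_Λ(a) < 1`. [folklore] -/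
theorem half_sq_eq_mul_gaussClassicalResponse (hd : 0 < d) (Λ : Finset (Site d)) (a : Site d → ℝ) {s : ℝ} (hs : 0 < s)
    (hsg : s * dirichletEnergy Λ a < 1) (L : ℝ) :
    L ^ 2 / 2 = (1 - s * dirichletEnergy Λ a) *
      ((sInf ((fun ψ : Site d → ℝ => dirichletForm Λ ψ / 2 - 0 / 2 * (L + ∑ y ∈ Λ, a y * ψ y) ^ 2) ''
            {ψ : Site d → ℝ | ∀ y ∉ Λ, ψ y = 0}) -
          sInf ((fun ψ : Site d → ℝ => dirichletForm Λ ψ / 2 - s / 2 * (L + ∑ y ∈ Λ, a y * ψ y) ^ 2) ''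
            {ψ : Site d → ℝ | ∀ y ∉ Λ, ψ y = 0})) / s) := by
  rw [gaussClassicalResponse_eq hd Λ a hs hsg L]
  have h1 : (1 - s * dirichletEnergy Λ a) ≠ 0 := by intro h; linarith
  field_simp

end Dirichlet

/-! ## §4 The bond charge `δ_{x+e_j} − δ_x`: its Dirichlet energy is the Dirichlet variance of the gradient; THE SPLIT in the lattice GFF -/

section Split

variable {d : ℕ} {ν : Measure (Site d → ℝ)}

/-- Pairing with the bond charge `δ_p − δ_q` is the difference of values (`p, q ∈ Λ`). [folklore] -/
theorem sum_bondCharge_mul {Λ : Finset (Site d)} {p q : Site d} (hp : p ∈ Λ) (hq : q ∈ Λ) (ψ : Site d → ℝ) :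
    ∑ y ∈ Λ, ((if y = p then (1 : ℝ) else 0) - (if y = q then 1 else 0)) * ψ y = ψ p - ψ q := by
  simp only [sub_mul, Finset.sum_sub_distrib, ite_mul, one_mul, zero_mul, Finset.sum_ite_eq' Λ, if_pos hp, if_pos hq]

/-- A double sum against the bond charge `δ_p − δ_q` picks out four kernel entries. [folklore] -/
theorem sum_sum_bondCharge_mul (Λ : Finset (Site d)) {p q : Site d} (hp : p ∈ Λ) (hq : q ∈ Λ) (K : Site d → Site d → ℝ) :
    ∑ y ∈ Λ, ∑ z ∈ Λ, ((if y = p then (1 : ℝ) else 0) - (if y = q then 1 else 0)) *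
        ((if z = p then (1 : ℝ) else 0) - (if z = q then 1 else 0)) * K y z =
      K p p - K p q - K q p + K q q := by
  have inner : ∀ y ∈ Λ, ∑ z ∈ Λ, ((if y = p then (1 : ℝ) else 0) - (if y = q then 1 else 0)) *
      ((if z = p then (1 : ℝ) else 0) - (if z = q then 1 else 0)) * K y z =
      ((if y = p then (1 : ℝ) else 0) - (if y = q then 1 else 0)) * (K y p - K y q) := by
    intro y _
    simp_rw [mul_assoc]
    rw [← Finset.mul_sum, sum_bondCharge_mul hp hq (K y)]
  rw [Finset.sum_congr rfl inner, sum_bondCharge_mul hp hq (fun y => K y p - K y q)]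
  ring

/-- **The Dirichlet energy of the bond charge is the Dirichlet variance of the gradient**: for the lattice GFF `ν` of `ℤ^d` (`d ≥ 3`) and
`x, x' ∈ Λ`, `E_Λ(δ_{x'} − δ_x) = ∫ (ψ^Λ_{x'} − ψ^Λ_x)² dν` (`= G_Λ(x',x') − 2G_Λ(x,x') + G_Λ(x,x)`). [cite: FriedliVelenik2017, Ch. 8 Thm. 8.21] -/
theorem dirichletEnergy_bondCharge_eq_integral (hν : IsDiscreteGFF ν (coordProc d)) (hd : 3 ≤ d) {Λ : Finset (Site d)}
    {x x' : Site d} (hx : x ∈ Λ) (hx' : x' ∈ Λ) :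
    dirichletEnergy Λ (fun y => (if y = x' then (1 : ℝ) else 0) - (if y = x then 1 else 0)) =
      ∫ φ, (dirichletField Λ φ x' - dirichletField Λ φ x) ^ 2 ∂ν := by
  rw [dirichletEnergy_eq_sum_sum, sum_sum_bondCharge_mul Λ hx' hx]
  have hψ2 : ∀ y : Site d, MemLp (fun φ : Site d → ℝ => dirichletField Λ φ y) 2 ν := fun y =>
    ((hν.isGaussianProcess_dirichletField Λ).hasGaussianLaw_eval y).memLp_two
  have hint : ∀ y z : Site d, Integrable (fun φ : Site d → ℝ => dirichletField Λ φ y * dirichletField Λ φ z) ν :=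
    fun y z => (hψ2 y).integrable_mul (hψ2 z)
  have e1 : ∀ φ : Site d → ℝ, (dirichletField Λ φ x' - dirichletField Λ φ x) ^ 2 =
      dirichletField Λ φ x' * dirichletField Λ φ x' - dirichletField Λ φ x' * dirichletField Λ φ x -
        dirichletField Λ φ x * dirichletField Λ φ x' + dirichletField Λ φ x * dirichletField Λ φ x := fun φ => by ring
  simp_rw [e1]
  have i12 : Integrable (fun φ : Site d → ℝ => dirichletField Λ φ x' * dirichletField Λ φ x' -
      dirichletField Λ φ x' * dirichletField Λ φ x) ν := (hint _ _).sub (hint _ _)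
  have i123 : Integrable (fun φ : Site d → ℝ => dirichletField Λ φ x' * dirichletField Λ φ x' -
      dirichletField Λ φ x' * dirichletField Λ φ x - dirichletField Λ φ x * dirichletField Λ φ x') ν := i12.sub (hint _ _)
  rw [integral_add i123 (hint _ _), integral_sub i12 (hint _ _), integral_sub (hint _ _) (hint _ _)]
  simp only [hν.integral_dirichletField_mul hd]

/-- **A dimension-free bound on the Dirichlet variance of a gradient**: `E_Λ(δ_{x+e_j} − δ_x) ≤ latticeGreen 0 − latticeGreen e_j` (`d ≥ 3`):
the Dirichlet covariance is dominated by the free one (tree `dirichletEnergy_le_half_greenEnergy`). [cite: GlimmJaffe1987, §7.7 (7.7.4) with §9.5] -/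
theorem dirichletEnergy_bondCharge_le (hd : 3 ≤ d) {Λ : Finset (Site d)} {x : Site d} {j : Fin d} (hx : x ∈ Λ)
    (hxe : x + e j ∈ Λ) :
    dirichletEnergy Λ (fun y => (if y = x + e j then (1 : ℝ) else 0) - (if y = x then 1 else 0)) ≤
      latticeGreen (0 : Site d) - latticeGreen (e j) := by
  have h := dirichletEnergy_le_half_greenEnergy d hd Λ (fun y => (if y = x + e j then (1 : ℝ) else 0) - (if y = x then 1 else 0))
  refine h.trans (le_of_eq ?_)
  unfold greenEnergy
  rw [sum_sum_bondCharge_mul Λ hxe hx (fun y z => latticeGreen (y - z))]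
  simp only [sub_self, add_sub_cancel_left, latticeGreen_sub_comm x (x + e j)]
  ring

/-- In `d = 4`: `E_Λ(δ_{x+e_j} − δ_x) ≤ latticeGreen 0 < 5/16` (tree `latticeGreen_four_zero_lt`), so every tilt `s ∈ [0,1]` is admissible,
`11/16 < 1 − s·E_Λ ≤ 1`. [cite: SalmhoferSeiler1991, (A.60)] -/
theorem dirichletEnergy_bondCharge_lt_four {Λ : Finset (Site 4)} {x : Site 4} {j : Fin 4} (hx : x ∈ Λ) (hxe : x + e j ∈ Λ) :
    dirichletEnergy Λ (fun y => (if y = x + e j then (1 : ℝ) else 0) - (if y = x then 1 else 0)) < 5 / 16 :=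
  (((dirichletEnergy_bondCharge_le (by norm_num) hx hxe)).trans
    (sub_le_self _ (latticeGreen_nonneg 4 (by norm_num) _))).trans_lt latticeGreen_four_zero_lt

/-- **THE SPLIT in the free field (exact, zero influence, two-sided).**  For the lattice GFF `ν` of `ℤ^d` (`d ≥ 3`), finite `Λ`, bond
`(x, x+e_j) ⊆ Λ`: the kernel of the bond energy `Q = ½(∇_jφ(x))²` given the exterior field, centred at its mean, IS the centred background bond energy,
`ν[Q | σ(φ_w : w ∉ Λ)] − ∫Q dν = Q(h) − ∫Q(h) dν` a.e., `h = φ − ψ^Λ` — and `Q(h) = (1 − s g)·CR_s` (`half_sq_eq_mul_gaussClassicalResponse` with the bond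
charge, `g = E_Λ(δ_{x+e_j} − δ_x)`): all exterior dependence of the kernel is the classical response of the cube. [cite: FriedliVelenik2017, Ch. 8 Thm. 8.21] -/
theorem condExp_bondEnergy_sub_integral (hν : IsDiscreteGFF ν (coordProc d)) (hd : 3 ≤ d) (Λ : Finset (Site d)) {x : Site d}
    {j : Fin d} (hx : x ∈ Λ) (hxe : x + e j ∈ Λ) :
    (fun φ => (ν[fun φ' : Site d → ℝ => (φ' (x + e j) - φ' x) ^ 2 / 2 |
        MeasurableSpace.comap (fun (φ' : Site d → ℝ) (w : {w : Site d // w ∉ Λ}) => φ' w) inferInstance]) φ -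
        ∫ φ', (φ' (x + e j) - φ' x) ^ 2 / 2 ∂ν) =ᵐ[ν]
      fun φ => ((φ (x + e j) - dirichletField Λ φ (x + e j)) - (φ x - dirichletField Λ φ x)) ^ 2 / 2 -
        ∫ φ', ((φ' (x + e j) - dirichletField Λ φ' (x + e j)) - (φ' x - dirichletField Λ φ' x)) ^ 2 / 2 ∂ν := by
  have hP := hν.1.isProbabilityMeasure
  have hext_m : Measurable (fun (φ' : Site d → ℝ) (w : {w : Site d // w ∉ Λ}) => φ' w) :=
    measurable_pi_lambda _ fun w => measurable_pi_apply _
  have hkey := condExp_gradient_sq_exterior hν hd Λ hx hxe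
  simp only [← e_def] at hkey
  have hψ2 : ∀ y : Site d, MemLp (fun φ : Site d → ℝ => dirichletField Λ φ y) 2 ν := fun y =>
    ((hν.isGaussianProcess_dirichletField Λ).hasGaussianLaw_eval y).memLp_two
  have hQ : Integrable (fun φ : Site d → ℝ => ((φ (x + e j) - dirichletField Λ φ (x + e j)) -
      (φ x - dirichletField Λ φ x)) ^ 2) ν :=
    (((hν.memLp_coord _).sub (hψ2 _)).sub ((hν.memLp_coord _).sub (hψ2 _))).integrable_sq
  -- the kernel of `Q = (∇φ)²/2` is half the kernel of `(∇φ)²`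
  have hhalf : ν[fun φ' : Site d → ℝ => (φ' (x + e j) - φ' x) ^ 2 / 2 |
      MeasurableSpace.comap (fun (φ' : Site d → ℝ) (w : {w : Site d // w ∉ Λ}) => φ' w) inferInstance] =ᵐ[ν]
      fun φ => (((φ (x + e j) - dirichletField Λ φ (x + e j)) - (φ x - dirichletField Λ φ x)) ^ 2 +
        ∫ φ', (dirichletField Λ φ' (x + e j) - dirichletField Λ φ' x) ^ 2 ∂ν) / 2 := by
    have e1 : (fun φ' : Site d → ℝ => (φ' (x + e j) - φ' x) ^ 2 / 2) =
        (1 / 2 : ℝ) • fun φ' : Site d → ℝ => (φ' (x + e j) - φ' x) ^ 2 := by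
      funext φ'; simp only [Pi.smul_apply, smul_eq_mul]; ring
    rw [e1]
    filter_upwards [condExp_smul (μ := ν) (1 / 2 : ℝ) (fun φ' : Site d → ℝ => (φ' (x + e j) - φ' x) ^ 2)
      (MeasurableSpace.comap (fun (φ' : Site d → ℝ) (w : {w : Site d // w ∉ Λ}) => φ' w) inferInstance), hkey] with φ h1 h2
    rw [h1, Pi.smul_apply, smul_eq_mul, h2]
    ring
  -- the means: integrate the kernel identity
  have hmean : ∫ φ', (φ' (x + e j) - φ' x) ^ 2 ∂ν =
      ∫ φ', ((φ' (x + e j) - dirichletField Λ φ' (x + e j)) - (φ' x - dirichletField Λ φ' x)) ^ 2 ∂ν +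
        ∫ φ', (dirichletField Λ φ' (x + e j) - dirichletField Λ φ' x) ^ 2 ∂ν := by
    rw [← integral_condExp hext_m.comap_le (f := fun φ' : Site d → ℝ => (φ' (x + e j) - φ' x) ^ 2),
      integral_congr_ae hkey, integral_add hQ (integrable_const _), integral_const, probReal_univ, one_smul]
  filter_upwards [hhalf] with φ hφ
  rw [hφ, integral_div, integral_div, hmean]
  ring

/-- **(split-cl) in the free field, upper half**: a.e. `|ν[Q|ext] − ∫Q| ≤ Q(h) + ∫Q(h) dν` (`Q(h) = (1 − s g)·CR_s` the carrier, `∫Q(h)` the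
R-uniform `A₀`-term of §5, influence `≡ 0`); the lower half `Q(h) − ∫Q(h) ≤ ν[Q|ext] − ∫Q` is `condExp_bondEnergy_sub_integral` itself. [folklore] -/
theorem abs_condExp_bondEnergy_sub_integral_le (hν : IsDiscreteGFF ν (coordProc d)) (hd : 3 ≤ d) (Λ : Finset (Site d)) {x : Site d}
    {j : Fin d} (hx : x ∈ Λ) (hxe : x + e j ∈ Λ) :
    ∀ᵐ φ ∂ν, |(ν[fun φ' : Site d → ℝ => (φ' (x + e j) - φ' x) ^ 2 / 2 |
        MeasurableSpace.comap (fun (φ' : Site d → ℝ) (w : {w : Site d // w ∉ Λ}) => φ' w) inferInstance]) φ -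
        ∫ φ', (φ' (x + e j) - φ' x) ^ 2 / 2 ∂ν| ≤
      ((φ (x + e j) - dirichletField Λ φ (x + e j)) - (φ x - dirichletField Λ φ x)) ^ 2 / 2 +
        ∫ φ', ((φ' (x + e j) - dirichletField Λ φ' (x + e j)) - (φ' x - dirichletField Λ φ' x)) ^ 2 / 2 ∂ν := by
  filter_upwards [condExp_bondEnergy_sub_integral hν hd Λ hx hxe] with φ hφ
  rw [hφ]
  have h1 : 0 ≤ ((φ (x + e j) - dirichletField Λ φ (x + e j)) - (φ x - dirichletField Λ φ x)) ^ 2 / 2 := by positivity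
  have h2 : 0 ≤ ∫ φ', ((φ' (x + e j) - dirichletField Λ φ' (x + e j)) - (φ' x - dirichletField Λ φ' x)) ^ 2 / 2 ∂ν :=
    integral_nonneg fun φ' => by positivity
  exact abs_sub_le_of_nonneg_of_le h1 (le_add_of_nonneg_right h2) h2 (le_add_of_nonneg_left h1)

end Split

/-! ## §5 `d = 4`, cubes of side `2R+3`: (split-cl) in the letters of `ClassicalResponse.SplitCl`, R-uniformly -/

section Four

variable {ν : Measure (Site 4 → ℝ)}

/-- **(split-cl) HOLDS in the free field — zero influence, two-sided, R-uniform.**  There is an absolute `v > 0` such that for the lattice GFF `ν`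
of `ℤ⁴`, every `R ≥ 1`, direction `j`, centre `x`, cube `Λ = x + sbox(R+1)` and tilt `s ∈ [0,1]`, with `Q = ½(∇_jφ(x))²`, `kerE = ν[Q | σ(φ_w : w ∉ Λ)]`,
`p = ∫Q dν`, `Q(h)` the background bond energy, `g = E_Λ(δ_{x+e_j} − δ_x)`:  `11/16 ≤ 1 − s g`, and a.e.  `R⁴·|kerE − p| ≤ v/2 + R⁴·Q(h)` and
`R⁴·Q(h) − v/2 ≤ R⁴·(kerE − p)`, where `Q(h) = (1 − s g)·CR_s ≤ CR_s` (`half_sq_eq_mul_gaussClassicalResponse`).  In the letters of `ClassicalResponse.SplitCl`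
(β = 1, `C₁ = 1`): `A₀ = v/2`, carrier `R⁴·CR_s` (= `carrierCl`, `C = 1`), `influenceAt ≡ 0` — and the carrier is also a LOWER bound.
[cite: FriedliVelenik2017, Ch. 8 Thm. 8.21] -/
theorem gff_splitCl (hν : IsDiscreteGFF ν (coordProc 4)) :
    ∃ v : ℝ, 0 < v ∧ ∀ (R : ℕ), 1 ≤ R → ∀ (j : Fin 4) (x : Site 4) (s : ℝ), 0 ≤ s → s ≤ 1 →
      11 / 16 ≤ 1 - s * dirichletEnergy ((sbox (R + 1)).image (fun z => x + z))
          (fun y => (if y = x + e j then (1 : ℝ) else 0) - (if y = x then 1 else 0)) ∧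
      ∀ᵐ φ ∂ν,
        (R : ℝ) ^ 4 * |(ν[fun φ' : Site 4 → ℝ => (φ' (x + e j) - φ' x) ^ 2 / 2 |
            MeasurableSpace.comap (fun (φ' : Site 4 → ℝ) (w : {w : Site 4 // w ∉ (sbox (R + 1)).image (fun z => x + z)}) => φ' w)
              inferInstance]) φ - ∫ φ', (φ' (x + e j) - φ' x) ^ 2 / 2 ∂ν| ≤
          v / 2 + (R : ℝ) ^ 4 * (((φ (x + e j) - dirichletField ((sbox (R + 1)).image (fun z => x + z)) φ (x + e j)) -
            (φ x - dirichletField ((sbox (R + 1)).image (fun z => x + z)) φ x)) ^ 2 / 2) ∧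
        (R : ℝ) ^ 4 * (((φ (x + e j) - dirichletField ((sbox (R + 1)).image (fun z => x + z)) φ (x + e j)) -
            (φ x - dirichletField ((sbox (R + 1)).image (fun z => x + z)) φ x)) ^ 2 / 2) - v / 2 ≤
          (R : ℝ) ^ 4 * ((ν[fun φ' : Site 4 → ℝ => (φ' (x + e j) - φ' x) ^ 2 / 2 |
            MeasurableSpace.comap (fun (φ' : Site 4 → ℝ) (w : {w : Site 4 // w ∉ (sbox (R + 1)).image (fun z => x + z)}) => φ' w)
              inferInstance]) φ - ∫ φ', (φ' (x + e j) - φ' x) ^ 2 / 2 ∂ν) := by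
  obtain ⟨v, hv0, hv⟩ := gff_integral_centreGradient_sq_le hν
  refine ⟨v, hv0, fun R hR j x s hs0 hs1 => ?_⟩
  have h := hv R hR j x
  set Λ : Finset (Site 4) := (sbox (R + 1)).image (fun z => x + z) with hΛ
  have hx : x ∈ Λ := by have h := add_mem_image_sbox x (zero_mem_sbox (R + 1)); rwa [add_zero] at h
  have hxe : x + e j ∈ Λ := add_mem_image_sbox x (e_mem_sbox (by omega) j)
  have hg0 : 0 ≤ dirichletEnergy Λ (fun y => (if y = x + e j then (1 : ℝ) else 0) - (if y = x then 1 else 0)) :=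
    dirichletEnergy_nonneg (by norm_num) Λ _
  have hg1 := dirichletEnergy_bondCharge_lt_four hx hxe
  refine ⟨by nlinarith, ?_⟩
  have hmean : (R : ℝ) ^ 4 * ∫ φ', ((φ' (x + e j) - dirichletField Λ φ' (x + e j)) - (φ' x - dirichletField Λ φ' x)) ^ 2 / 2 ∂ν ≤
      v / 2 := by
    have hR4 : (0 : ℝ) < (R : ℝ) ^ 4 := by positivity
    rw [le_div_iff₀ hR4] at h
    rw [integral_div]
    linarith
  filter_upwards [abs_condExp_bondEnergy_sub_integral_le hν (by norm_num) Λ hx hxe,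
    condExp_bondEnergy_sub_integral hν (by norm_num) Λ hx hxe] with φ h1 h2
  have hR4 : (0 : ℝ) ≤ (R : ℝ) ^ 4 := by positivity
  constructor
  · have h3 := mul_le_mul_of_nonneg_left h1 hR4
    rw [mul_add] at h3
    linarith
  · rw [h2, mul_sub]
    linarith

end Four

end Summit.QuantumFields.YangMills.Cruxes.UVSeamRec.GaussianCalibration

end
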